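import Summits.AtomisticToContinuum.HydrodynamicLimit.Theorems.RelayRaceLocalityRestartPrincipleStubFiniteSize
import Summits.AtomisticToContinuum.HydrodynamicLimit.Theorems.RestartPrinciple.Negative.StubRestartableHLOfGuardedConjunct
import HarnessLib

/-!
# `RestartPrinciple` (stmt-AtomisticToContinuum-12503): the restart induction in FLOORED restartable currency

Support file (`--supports stmt-AtomisticToContinuum-12503`), route `RelayRaceLocality`, lead c17
(prover-line-stmt-AtomisticToContinuum-12503-c17-0, 2026-08-17).

The crux `RestartPrinciple = (S → G)` has `G` verbatim the sub-problem decl `_root_.HydrodynamicLimit`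
(statement re-type p126922) and an antecedent `S` (short-time guarded limit from time-`0` local Gibbs data,
prefix `∃ η₀ ∀ M ∃ τ₁ … ∃ σ₀`) that no proof can consume (`RestartPrincipleNegative.prefixMfirst_schema_false`,
`anchored_schema_false`, p99454). The sister crux `ConeLocalisation` (stmt-12504) is proved only in FLOORED
form `LightConeInLaw → NearConstantShortTimeHL → S♭` (`ConeLocalisation.coneLocalisationFloored_holds`, p137065),
`S♭` = `S` with the density floor `M⁻¹ ≤ ρ s x` inserted after `ρ s x ≤ M` (`ConeLocalisation.ShortTimeGuardedHLFloored`).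
The crux strategist's census (`Cruxes/RestartPrinciple/STRATEGY-CENSUS.md` §Disposition, item 3) recommends
restating stmt-12503 + stmt-12504 jointly in floored RESTARTABLE currency — `RP♭♯ := RHL♭ → G` with
`RHL♭` the short-time limit along the true law restartable from any `s₀ ∈ [0, T)` (prefix
`∃ η₀ ∀ profile ∃ σ₀ ∀ σ < σ₀ ∀ M ∃ τ₁`), floored guard list of `S♭` — "closing at once by the landed
induction (p108006 pattern)". That pattern (`guardedConjunct_of_restartableHL`,
`Theorems/RelayRaceLocalityRestartPrincipleReduction.lean`) is UNfloored; this file lands the floored one,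
so the restated item closes by a term of this file and the upstream burden is certified exactly:

* `finiteSizeFloored` — a classical hard-sphere Euler solution has, on every `[0, t] ⊂ [0, T)`, ONE level
  `M > 0` with `M⁻¹ ≤ ρ ≤ M`, `M⁻¹ ≤ θ ≤ M`, `‖u‖ ≤ M` and all spatial derivatives of `(ρ, u, θ)` of
  orders `1, 2, 3` bounded by `M` (`stub_finiteSize`, p96553, plus `density_pos` and compactness for `ρ⁻¹`);
* `hydrodynamicLimit_of_restartableHLFloored : RHL♭ → _root_.HydrodynamicLimit` — THE FLOORED RESTART
  INDUCTION over the grid `n · τ₁(M(t)) / 2` along the given classical solution;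
* `restartPrinciple_of_restartableHLFloored : RHL♭ → RestartPrinciple` (the antecedent `S` is discarded);
* `restartableHLFloored_of_hydrodynamicLimit : _root_.HydrodynamicLimit → RHL♭` (zero slack: the disprover's
  `RestartPrincipleNegative.guardedConjunct_imp_stubRestartableHL`, p103746, and guard monotonicity), whence
  `restartableHLFloored_iff_hydrodynamicLimit : RHL♭ ↔ _root_.HydrodynamicLimit` — the floored restartable
  currency carries exactly the burden of the conjunct, so the restatement's new upstream item
  `ConeLocalisation♯ : LightConeInLaw → NearConstantShortTimeHL → RHL♭` is the route's Assembly in substance.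

No definitions: `RHL♭` is spelled out verbatim (guard list token-identical to `ShortTimeGuardedHLFloored`).
References: H. Spohn, *Large Scale Dynamics of Interacting Particles* (1991), Part I Ch. 3;
S. Olla – S. R. S. Varadhan – H.-T. Yau, Comm. Math. Phys. 155 (1993), §1.
-/

noncomputable section

open Literature.MathematicalPhysics.KineticTheory Literature.Analysis.FluidPDE
open Literature.Analysis.FunctionSpaces MeasureTheory Filter Set
open Summit.AtomisticToContinuum.HydrodynamicLimit.Theses.RelayRaceLocality

namespace Summit.AtomisticToContinuum.HydrodynamicLimit.Theorems.RestartPrinciple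

/-- **Finite size with a density floor.** For a classical hard-sphere Euler solution on `[0, T) × 𝕋³` and
every `t < T` there is one level `M > 0` such that on `[0, t] × 𝕋³`: `ρ ≤ M`, `M⁻¹ ≤ ρ`, `θ ≤ M`, `M⁻¹ ≤ θ`,
`‖u‖ ≤ M`, and all spatial partial derivatives of `ρ, u, θ` of orders `1, 2, 3` are bounded by `M`
(`stub_finiteSize` for everything but the density floor; `ρ⁻¹` is jointly smooth since `ρ > 0` on `[0, T)`,
hence bounded on the compact `[0, t]`; take the maximum of the two levels). [folklore] -/
theorem finiteSizeFloored :
    ∀ (σ T : ℝ) (ρ θ : ℝ → T3 → ℝ) (u : ℝ → T3 → V3), IsHardSphereEulerSolution σ T ρ u θ →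
      ∀ t : ℝ, t < T → ∃ M : ℝ, 0 < M ∧ ∀ s ∈ Set.Icc 0 t, ∀ x, ρ s x ≤ M ∧ M⁻¹ ≤ ρ s x ∧ θ s x ≤ M ∧
        M⁻¹ ≤ θ s x ∧ ‖u s x‖ ≤ M ∧ ∀ i j k : Fin 3, |Torus.partialDeriv i (ρ s) x| ≤ M ∧
        ‖Torus.partialDeriv i (u s) x‖ ≤ M ∧ |Torus.partialDeriv i (θ s) x| ≤ M ∧
        |Torus.partialDeriv i (Torus.partialDeriv j (ρ s)) x| ≤ M ∧
        ‖Torus.partialDeriv i (Torus.partialDeriv j (u s)) x‖ ≤ M ∧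
        |Torus.partialDeriv i (Torus.partialDeriv j (θ s)) x| ≤ M ∧
        |Torus.partialDeriv i (Torus.partialDeriv j (Torus.partialDeriv k (ρ s))) x| ≤ M ∧
        ‖Torus.partialDeriv i (Torus.partialDeriv j (Torus.partialDeriv k (u s))) x‖ ≤ M ∧
        |Torus.partialDeriv i (Torus.partialDeriv j (Torus.partialDeriv k (θ s))) x| ≤ M := by
  intro σ T ρ θ u hsol t ht
  obtain ⟨M₁, hM₁, h₁⟩ := stub_finiteSize σ T ρ θ u hsol t ht
  -- `ρ⁻¹` is jointly smooth (`ρ > 0` on `[0, T)`), hence bounded on the compact `[0, t] ⊆ [0, T)`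
  have hKS : Icc 0 t ⊆ Ico 0 T := Icc_subset_Ico_right ht
  have hρinv : Torus.IsSmoothSpaceTimeOn (Ico 0 T) (fun s x => (ρ s x)⁻¹) :=
    hsol.smooth_density.comp_contDiffOn (contDiffOn_inv ℝ) fun s hs x =>
      mem_compl_singleton_iff.2 (hsol.density_pos s hs x).ne'
  obtain ⟨C, hC⟩ := hρinv.exists_norm_le_of_isCompact isCompact_Icc hKS
  refine ⟨max M₁ C, lt_max_of_lt_left hM₁, fun s hs x => ?_⟩
  obtain ⟨hρ, hθ, hθi, hu, hd⟩ := h₁ s hs x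
  have hM₁le : M₁ ≤ max M₁ C := le_max_left _ _
  have hρpos : 0 < ρ s x := hsol.density_pos s (hKS hs) x
  refine ⟨hρ.trans hM₁le, ?_, hθ.trans hM₁le, ?_, hu.trans hM₁le, fun i j k => ?_⟩
  · -- density floor: `(ρ s x)⁻¹ ≤ C ≤ max M₁ C`
    have h1 : (ρ s x)⁻¹ ≤ max M₁ C :=
      ((Real.le_norm_self _).trans (hC s hs x)).trans (le_max_right _ _)
    exact inv_le_of_inv_le₀ hρpos h1
  · exact (inv_anti₀ hM₁ hM₁le).trans hθi
  · obtain ⟨h1, h2, h3, h4, h5, h6, h7, h8, h9⟩ := hd i j k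
    exact ⟨h1.trans hM₁le, h2.trans hM₁le, h3.trans hM₁le, h4.trans hM₁le, h5.trans hM₁le,
      h6.trans hM₁le, h7.trans hM₁le, h8.trans hM₁le, h9.trans hM₁le⟩

/-- **Floored restart induction.** The short-time hydrodynamic limit in FLOORED restartable currency along
the true law — prefix `∃ η₀ ∀ profile ∃ σ₀ ∀ σ < σ₀ ∀ M ∃ τ₁`, restart from any `s₀ ∈ [0, T)` given the law
of large numbers on `[0, s₀]`, under packing `< η₀` and the floored size guards of
`ConeLocalisation.ShortTimeGuardedHLFloored` (`M⁻¹ ≤ ρ ≤ M`, `M⁻¹ ≤ θ ≤ M`, `‖u‖ ≤ M`, derivatives of order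
`≤ 3` bounded by `M`) on `[0, t]` — implies the packing-guarded conjunct `_root_.HydrodynamicLimit`: fix `t < T`,
take the floored level `M` of the classical solution on `[0, t]` (`finiteSizeFloored`), the restart step
`τ₁ = τ₁(M)`, and induct over the grid `n · τ₁ / 2`. -/
theorem hydrodynamicLimit_of_restartableHLFloored
    (hR : ∃ η₀ : ℝ, 0 < η₀ ∧ ∀ (a₀ θ₀ : T3 → ℝ) (u₀ : T3 → V3), Continuous a₀ → Continuous θ₀ →
      Continuous u₀ → (∀ x, 0 < a₀ x) → (∀ x, 0 < θ₀ x) → ∃ σ₀ : ℝ, 0 < σ₀ ∧ ∀ σ : ℝ, 0 < σ →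
      σ < σ₀ → ∀ M : ℝ, 0 < M → ∃ τ₁ : ℝ, 0 < τ₁ ∧ ∀ (T : ℝ) (ρ θ : ℝ → T3 → ℝ) (u : ℝ → T3 → V3),
      IsHardSphereEulerSolution σ T ρ u θ →
      ∀ Φ : (N : ℕ) → HardSphereFlow (Torus.geometry (Fin 3)) (hsDiameter σ N) (N + 1),
      ∀ s₀ ∈ Set.Ico 0 T,
      (∀ s ∈ Set.Icc 0 s₀,
        TendstoHydroFieldsAt (fun N => localGibbsLaw σ a₀ u₀ θ₀ N (Φ N)) Φ ρ u θ s) →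
      ∀ t ∈ Set.Ico s₀ (min T (s₀ + τ₁)),
      (∀ s ∈ Set.Icc 0 t, ∀ x, ρ s x * σ ^ 3 < η₀ ∧ ρ s x ≤ M ∧ M⁻¹ ≤ ρ s x ∧ θ s x ≤ M ∧
        M⁻¹ ≤ θ s x ∧ ‖u s x‖ ≤ M ∧ ∀ i j k : Fin 3, |Torus.partialDeriv i (ρ s) x| ≤ M ∧
        ‖Torus.partialDeriv i (u s) x‖ ≤ M ∧ |Torus.partialDeriv i (θ s) x| ≤ M ∧
        |Torus.partialDeriv i (Torus.partialDeriv j (ρ s)) x| ≤ M ∧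
        ‖Torus.partialDeriv i (Torus.partialDeriv j (u s)) x‖ ≤ M ∧
        |Torus.partialDeriv i (Torus.partialDeriv j (θ s)) x| ≤ M ∧
        |Torus.partialDeriv i (Torus.partialDeriv j (Torus.partialDeriv k (ρ s))) x| ≤ M ∧
        ‖Torus.partialDeriv i (Torus.partialDeriv j (Torus.partialDeriv k (u s))) x‖ ≤ M ∧
        |Torus.partialDeriv i (Torus.partialDeriv j (Torus.partialDeriv k (θ s))) x| ≤ M) →
      TendstoHydroFieldsAt (fun N => localGibbsLaw σ a₀ u₀ θ₀ N (Φ N)) Φ ρ u θ t) :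
    _root_.HydrodynamicLimit := by
  obtain ⟨η₀, hη₀, hS⟩ := hR
  refine ⟨η₀, hη₀, fun a₀ θ₀ u₀ ha hθ hu ha0 hθ0 => ?_⟩
  obtain ⟨σ₀, hσ₀, hS⟩ := hS a₀ θ₀ u₀ ha hθ hu ha0 hθ0
  refine ⟨σ₀, hσ₀, fun σ hσ hσσ₀ T ρ θ u hsol hpack Φ h0 t ht => ?_⟩
  -- the floored guard level on `[0, t]` and the restart step
  obtain ⟨M, hM, hsize⟩ := finiteSizeFloored σ T ρ θ u hsol t ht.2
  obtain ⟨τ₁, hτ₁, hstep⟩ := hS σ hσ hσσ₀ M hM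
  -- full floored guards on `[0, s]` for every `s ≤ t`
  have hguard : ∀ s, s ≤ t → ∀ s' ∈ Set.Icc 0 s, ∀ x, ρ s' x * σ ^ 3 < η₀ ∧ ρ s' x ≤ M ∧
      M⁻¹ ≤ ρ s' x ∧ θ s' x ≤ M ∧ M⁻¹ ≤ θ s' x ∧ ‖u s' x‖ ≤ M ∧ ∀ i j k : Fin 3,
      |Torus.partialDeriv i (ρ s') x| ≤ M ∧ ‖Torus.partialDeriv i (u s') x‖ ≤ M ∧
      |Torus.partialDeriv i (θ s') x| ≤ M ∧
      |Torus.partialDeriv i (Torus.partialDeriv j (ρ s')) x| ≤ M ∧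
      ‖Torus.partialDeriv i (Torus.partialDeriv j (u s')) x‖ ≤ M ∧
      |Torus.partialDeriv i (Torus.partialDeriv j (θ s')) x| ≤ M ∧
      |Torus.partialDeriv i (Torus.partialDeriv j (Torus.partialDeriv k (ρ s'))) x| ≤ M ∧
      ‖Torus.partialDeriv i (Torus.partialDeriv j (Torus.partialDeriv k (u s'))) x‖ ≤ M ∧
      |Torus.partialDeriv i (Torus.partialDeriv j (Torus.partialDeriv k (θ s'))) x| ≤ M := by
    intro s hs s' hs' x
    have hs't : s' ∈ Set.Icc 0 t := ⟨hs'.1, hs'.2.trans hs⟩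
    exact ⟨hpack s' ⟨hs'.1, lt_of_le_of_lt hs't.2 ht.2⟩ x, hsize s' hs't x⟩
  -- restart induction over the grid `n · (τ₁ / 2)`
  have key : ∀ n : ℕ, ∀ s ∈ Set.Icc 0 t, s ≤ n * (τ₁ / 2) →
      TendstoHydroFieldsAt (fun N => localGibbsLaw σ a₀ u₀ θ₀ N (Φ N)) Φ ρ u θ s := by
    intro n
    induction n with
    | zero =>
      intro s hs hsn
      have hs0 : s = 0 := le_antisymm (by simpa using hsn) hs.1
      rw [hs0]
      exact h0
    | succ n ih =>
      intro s hs hsn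
      by_cases hcase : s ≤ n * (τ₁ / 2)
      · exact ih s hs hcase
      · push Not at hcase
        set s₀ : ℝ := n * (τ₁ / 2) with hs₀def
        have hs₀nn : 0 ≤ s₀ := by positivity
        have hs₀s : s₀ < s := hcase
        have hs₀T : s₀ ∈ Set.Ico 0 T := ⟨hs₀nn, (hs₀s.trans_le hs.2).trans ht.2⟩
        have hprev : ∀ s' ∈ Set.Icc 0 s₀,
            TendstoHydroFieldsAt (fun N => localGibbsLaw σ a₀ u₀ θ₀ N (Φ N)) Φ ρ u θ s' :=
          fun s' hs' => ih s' ⟨hs'.1, hs'.2.trans (hs₀s.le.trans hs.2)⟩ hs'.2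
        have hsI : s ∈ Set.Ico s₀ (min T (s₀ + τ₁)) := by
          refine ⟨hs₀s.le, lt_min (hs.2.trans_lt ht.2) ?_⟩
          have h1 : s ≤ s₀ + τ₁ / 2 := by
            have : ((n + 1 : ℕ) : ℝ) * (τ₁ / 2) = s₀ + τ₁ / 2 := by push_cast; ring
            linarith [hsn, this]
          linarith
        exact hstep T ρ θ u hsol Φ s₀ hs₀T hprev s hsI (hguard s hs.2)
  -- reach `t` in finitely many steps
  obtain ⟨n, hn⟩ := exists_nat_ge (t / (τ₁ / 2))
  refine key n t ⟨ht.1, le_rfl⟩ ?_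
  have hτ2 : 0 < τ₁ / 2 := half_pos hτ₁
  rwa [div_le_iff₀ hτ2] at hn

/-- **The crux from the floored restartable short-time limit.** `RHL♭ → RestartPrinciple`: the consequent of
the crux is `_root_.HydrodynamicLimit` verbatim (`hydrodynamicLimit_of_restartableHLFloored`); the antecedent
`S` is discarded (it cannot be consumed: `RestartPrincipleNegative.prefixMfirst_schema_false` /
`anchored_schema_false`). This is the one-line close of the strategist's restated item `RP♭♯ := RHL♭ → G`. -/
theorem restartPrinciple_of_restartableHLFloored
    (hR : ∃ η₀ : ℝ, 0 < η₀ ∧ ∀ (a₀ θ₀ : T3 → ℝ) (u₀ : T3 → V3), Continuous a₀ → Continuous θ₀ →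
      Continuous u₀ → (∀ x, 0 < a₀ x) → (∀ x, 0 < θ₀ x) → ∃ σ₀ : ℝ, 0 < σ₀ ∧ ∀ σ : ℝ, 0 < σ →
      σ < σ₀ → ∀ M : ℝ, 0 < M → ∃ τ₁ : ℝ, 0 < τ₁ ∧ ∀ (T : ℝ) (ρ θ : ℝ → T3 → ℝ) (u : ℝ → T3 → V3),
      IsHardSphereEulerSolution σ T ρ u θ →
      ∀ Φ : (N : ℕ) → HardSphereFlow (Torus.geometry (Fin 3)) (hsDiameter σ N) (N + 1),
      ∀ s₀ ∈ Set.Ico 0 T,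
      (∀ s ∈ Set.Icc 0 s₀,
        TendstoHydroFieldsAt (fun N => localGibbsLaw σ a₀ u₀ θ₀ N (Φ N)) Φ ρ u θ s) →
      ∀ t ∈ Set.Ico s₀ (min T (s₀ + τ₁)),
      (∀ s ∈ Set.Icc 0 t, ∀ x, ρ s x * σ ^ 3 < η₀ ∧ ρ s x ≤ M ∧ M⁻¹ ≤ ρ s x ∧ θ s x ≤ M ∧
        M⁻¹ ≤ θ s x ∧ ‖u s x‖ ≤ M ∧ ∀ i j k : Fin 3, |Torus.partialDeriv i (ρ s) x| ≤ M ∧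
        ‖Torus.partialDeriv i (u s) x‖ ≤ M ∧ |Torus.partialDeriv i (θ s) x| ≤ M ∧
        |Torus.partialDeriv i (Torus.partialDeriv j (ρ s)) x| ≤ M ∧
        ‖Torus.partialDeriv i (Torus.partialDeriv j (u s)) x‖ ≤ M ∧
        |Torus.partialDeriv i (Torus.partialDeriv j (θ s)) x| ≤ M ∧
        |Torus.partialDeriv i (Torus.partialDeriv j (Torus.partialDeriv k (ρ s))) x| ≤ M ∧
        ‖Torus.partialDeriv i (Torus.partialDeriv j (Torus.partialDeriv k (u s))) x‖ ≤ M ∧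
        |Torus.partialDeriv i (Torus.partialDeriv j (Torus.partialDeriv k (θ s))) x| ≤ M) →
      TendstoHydroFieldsAt (fun N => localGibbsLaw σ a₀ u₀ θ₀ N (Φ N)) Φ ρ u θ t) :
    RestartPrinciple :=
  fun _ => hydrodynamicLimit_of_restartableHLFloored hR

/-- **Zero slack of the floored restartable currency.** `_root_.HydrodynamicLimit → RHL♭`: the conjunct gives
the UNfloored restartable statement (`RestartPrincipleNegative.guardedConjunct_imp_stubRestartableHL`, p103746:
restrict the classical solution to `[0, T')`, `T' > t`, with the packing guard kept by compactness), and the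
floored statement asks the same conclusion under MORE guard hypotheses (drop the floor `M⁻¹ ≤ ρ s x`). -/
theorem restartableHLFloored_of_hydrodynamicLimit (hG : _root_.HydrodynamicLimit) :
    ∃ η₀ : ℝ, 0 < η₀ ∧ ∀ (a₀ θ₀ : T3 → ℝ) (u₀ : T3 → V3), Continuous a₀ → Continuous θ₀ →
      Continuous u₀ → (∀ x, 0 < a₀ x) → (∀ x, 0 < θ₀ x) → ∃ σ₀ : ℝ, 0 < σ₀ ∧ ∀ σ : ℝ, 0 < σ →
      σ < σ₀ → ∀ M : ℝ, 0 < M → ∃ τ₁ : ℝ, 0 < τ₁ ∧ ∀ (T : ℝ) (ρ θ : ℝ → T3 → ℝ) (u : ℝ → T3 → V3),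
      IsHardSphereEulerSolution σ T ρ u θ →
      ∀ Φ : (N : ℕ) → HardSphereFlow (Torus.geometry (Fin 3)) (hsDiameter σ N) (N + 1),
      ∀ s₀ ∈ Set.Ico 0 T,
      (∀ s ∈ Set.Icc 0 s₀,
        TendstoHydroFieldsAt (fun N => localGibbsLaw σ a₀ u₀ θ₀ N (Φ N)) Φ ρ u θ s) →
      ∀ t ∈ Set.Ico s₀ (min T (s₀ + τ₁)),
      (∀ s ∈ Set.Icc 0 t, ∀ x, ρ s x * σ ^ 3 < η₀ ∧ ρ s x ≤ M ∧ M⁻¹ ≤ ρ s x ∧ θ s x ≤ M ∧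
        M⁻¹ ≤ θ s x ∧ ‖u s x‖ ≤ M ∧ ∀ i j k : Fin 3, |Torus.partialDeriv i (ρ s) x| ≤ M ∧
        ‖Torus.partialDeriv i (u s) x‖ ≤ M ∧ |Torus.partialDeriv i (θ s) x| ≤ M ∧
        |Torus.partialDeriv i (Torus.partialDeriv j (ρ s)) x| ≤ M ∧
        ‖Torus.partialDeriv i (Torus.partialDeriv j (u s)) x‖ ≤ M ∧
        |Torus.partialDeriv i (Torus.partialDeriv j (θ s)) x| ≤ M ∧
        |Torus.partialDeriv i (Torus.partialDeriv j (Torus.partialDeriv k (ρ s))) x| ≤ M ∧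
        ‖Torus.partialDeriv i (Torus.partialDeriv j (Torus.partialDeriv k (u s))) x‖ ≤ M ∧
        |Torus.partialDeriv i (Torus.partialDeriv j (Torus.partialDeriv k (θ s))) x| ≤ M) →
      TendstoHydroFieldsAt (fun N => localGibbsLaw σ a₀ u₀ θ₀ N (Φ N)) Φ ρ u θ t := by
  obtain ⟨η₀, hη₀, H⟩ := RestartPrincipleNegative.guardedConjunct_imp_stubRestartableHL hG
  refine ⟨η₀, hη₀, fun a₀ θ₀ u₀ ha hθ hu ha0 hθ0 => ?_⟩
  obtain ⟨σ₀, hσ₀, H⟩ := H a₀ θ₀ u₀ ha hθ hu ha0 hθ0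
  refine ⟨σ₀, hσ₀, fun σ hσ hσσ₀ M hM => ?_⟩
  obtain ⟨τ₁, hτ₁, H⟩ := H σ hσ hσσ₀ M hM
  refine ⟨τ₁, hτ₁, fun T ρ θ u hsol Φ s₀ hs₀ hprev t ht hguard => ?_⟩
  refine H T ρ θ u hsol Φ s₀ hs₀ hprev t ht fun s hs x => ?_
  obtain ⟨hp, hρ, -, hθ, hθi, hu, hd⟩ := hguard s hs x
  exact ⟨hp, hρ, hθ, hθi, hu, hd⟩

/-- **`RHL♭ ↔ _root_.HydrodynamicLimit`.** The floored restartable short-time hydrodynamic limit along the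
true law is EQUIVALENT to the packing-guarded conjunct (`hydrodynamicLimit_of_restartableHLFloored`,
`restartableHLFloored_of_hydrodynamicLimit`): the joint floored-restartable restatement of stmt-12503 /
stmt-12504 moves the whole burden of the conjunct, and nothing less, into the item that must deliver `RHL♭`. -/
theorem restartableHLFloored_iff_hydrodynamicLimit :
    (∃ η₀ : ℝ, 0 < η₀ ∧ ∀ (a₀ θ₀ : T3 → ℝ) (u₀ : T3 → V3), Continuous a₀ → Continuous θ₀ →
      Continuous u₀ → (∀ x, 0 < a₀ x) → (∀ x, 0 < θ₀ x) → ∃ σ₀ : ℝ, 0 < σ₀ ∧ ∀ σ : ℝ, 0 < σ →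
      σ < σ₀ → ∀ M : ℝ, 0 < M → ∃ τ₁ : ℝ, 0 < τ₁ ∧ ∀ (T : ℝ) (ρ θ : ℝ → T3 → ℝ) (u : ℝ → T3 → V3),
      IsHardSphereEulerSolution σ T ρ u θ →
      ∀ Φ : (N : ℕ) → HardSphereFlow (Torus.geometry (Fin 3)) (hsDiameter σ N) (N + 1),
      ∀ s₀ ∈ Set.Ico 0 T,
      (∀ s ∈ Set.Icc 0 s₀,
        TendstoHydroFieldsAt (fun N => localGibbsLaw σ a₀ u₀ θ₀ N (Φ N)) Φ ρ u θ s) →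
      ∀ t ∈ Set.Ico s₀ (min T (s₀ + τ₁)),
      (∀ s ∈ Set.Icc 0 t, ∀ x, ρ s x * σ ^ 3 < η₀ ∧ ρ s x ≤ M ∧ M⁻¹ ≤ ρ s x ∧ θ s x ≤ M ∧
        M⁻¹ ≤ θ s x ∧ ‖u s x‖ ≤ M ∧ ∀ i j k : Fin 3, |Torus.partialDeriv i (ρ s) x| ≤ M ∧
        ‖Torus.partialDeriv i (u s) x‖ ≤ M ∧ |Torus.partialDeriv i (θ s) x| ≤ M ∧
        |Torus.partialDeriv i (Torus.partialDeriv j (ρ s)) x| ≤ M ∧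
        ‖Torus.partialDeriv i (Torus.partialDeriv j (u s)) x‖ ≤ M ∧
        |Torus.partialDeriv i (Torus.partialDeriv j (θ s)) x| ≤ M ∧
        |Torus.partialDeriv i (Torus.partialDeriv j (Torus.partialDeriv k (ρ s))) x| ≤ M ∧
        ‖Torus.partialDeriv i (Torus.partialDeriv j (Torus.partialDeriv k (u s))) x‖ ≤ M ∧
        |Torus.partialDeriv i (Torus.partialDeriv j (Torus.partialDeriv k (θ s))) x| ≤ M) →
      TendstoHydroFieldsAt (fun N => localGibbsLaw σ a₀ u₀ θ₀ N (Φ N)) Φ ρ u θ t) ↔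
    _root_.HydrodynamicLimit :=
  ⟨hydrodynamicLimit_of_restartableHLFloored, restartableHLFloored_of_hydrodynamicLimit⟩

end Summit.AtomisticToContinuum.HydrodynamicLimit.Theorems.RestartPrinciple

end
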